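import Summits.QuantumFields.QCD.Theses.QuarksAsStableAction
import Summits.QuantumFields.QCD.Theses.WilsonQuarkChessboard
import Literature.MathematicalPhysics.QuantumLattice.WilsonDiracAP
import Literature.Probability.LatticeModels.TorusFourierProofs

/-!
# Stub `stub_tilingStability_of` of line `Sketch` (idea `free-tangent-landau-chessboard`)
(crux `Summit.QuantumFields.QCD.Theses.QuarksAsStableAction.WilsonQuarkStability`, item stmt-QuantumFields-9736,
route route-QuantumFields-QuarksAsStableAction)

This file proves `stub_tilingStability_of : FreeTangentBound → CellGauge → TilingStability` (stated
unfolded): Theorem A of the line (the free-tangent bound `‖det D[ω • V]‖ ≤ e^{C_A F(V)} ‖det D[ω • 1]‖`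
for the Wilson–Dirac determinant in the constant central phase `ω = e^{iπ/L}·1 ∈ U(3)`, gauge `1`,
`F(V) = Σ_e (3 - Re tr V_e)`) and Theorem B (cell gauge fixing on the closed unit hypercube) imply
stability of the period-2 reflection tilings `tile_c V` of `QuarkChessboard` with the antiperiodic
seam `apTwistAt (fun _ => -1)` on even tori, with constants `ε_A`, `C := 4 C_A max(C_B, 0)`,
`L₀ := max(L₀^A, 4)`.  Proof.
(a) SEAM ↔ PHASE (`gaugeTransform_phase_eq_apTwistAt`): with `s x := ω ^ (Σ_ν val x_ν)` one has
`(ω • W)^s = apTwistAt (-1) W` (`ω` is central; the exponent grows by `1` along a link off the seam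
and drops by `L - 1` across it, and `ω^L = e^{iπ} = -1`), so by gauge invariance of the fermion
determinant (`fermionDet_wilsonDirac_gaugeTransform`) `det D[apTwistAt (-1) W] = det D[ω • W]`.
(b) EVERY GAUGE (`norm_det_apTwistAt_le`): with `apTwistAt_gaugeTransform`, Theorem A holds in the
seam picture for `W^g`, any gauge `g`.
(c) FOLD IDENTITY (`gaugeTransform_tile`, even `L`): `(tile_c V)^{g ∘ fold_c} = tile_c (V^g)`,
`fold_c x = c + ((x - c) mod 2)`; the two cases of the tiling are `fold (x + μ̂) = fold x + μ̂`
(even `μ`-offset) and `fold (x + μ̂) + μ̂ = fold x` (odd), consistent at the wrap because `L` is even.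
(d) LINK COUNT (`sum_deficit_tile_le`): every link of `tile_c X` is `X(ℓ)^{±1}` for a cell link `ℓ`
and `Re tr u⁻¹ = Re tr u`, deficits are `≥ 0`, so `F(tile_c X) ≤ 4L⁴ · Σ_{cell links} deficit(X)`.
(e) Assemble with the cell gauge `g_c` of Theorem B.  Pure theorem file (no `def`s).
-/

namespace Summit.QuantumFields.QCD.Cruxes.WilsonQuarkStability.FreeTangentLandauChessboard

open Literature.MathematicalPhysics Literature.MathematicalPhysics.QuantumLattice
  Literature.MathematicalPhysics.QuantumFieldTheory Literature.Probability.LatticeModels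
open Matrix Complex
open scoped Kronecker ComplexOrder ComplexConjugate BigOperators

noncomputable section

/-- The constant phase matrix `e^{iπ/L}·1` is unitary. -/
private theorem phase_mem_unitaryGroup (L : ℕ) :
    Complex.exp (↑(Real.pi / L) * I) • (1 : Matrix (Fin 3) (Fin 3) ℂ) ∈
      Matrix.unitaryGroup (Fin 3) ℂ := by
  refine Unitary.smul_mem_of_mem ?_ (one_mem _)
  rw [Unitary.mem_iff, Complex.star_def, Complex.conj_mul', Complex.mul_conj',
    Complex.norm_exp_ofReal_mul_I]
  simp

/-- A scalar unitary matrix is central in `U(3)`. -/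
private theorem phase_comm {L : ℕ} {ω : Matrix.unitaryGroup (Fin 3) ℂ}
    (hω : (ω : Matrix (Fin 3) (Fin 3) ℂ) = Complex.exp (↑(Real.pi / L) * I) • (1 : Matrix (Fin 3) (Fin 3) ℂ))
    (u : Matrix.unitaryGroup (Fin 3) ℂ) : Commute ω u := by
  rw [Commute, SemiconjBy]
  apply Subtype.ext
  change (ω : Matrix (Fin 3) (Fin 3) ℂ) * u = u * ω
  rw [hω, smul_mul_assoc, one_mul, mul_smul_comm, mul_one]

/-- `ω_L ^ L = -1`: `(e^{iπ/L})^L = e^{iπ} = -1`. -/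
private theorem phase_pow {L : ℕ} [NeZero L] {ω : Matrix.unitaryGroup (Fin 3) ℂ}
    (hω : (ω : Matrix (Fin 3) (Fin 3) ℂ) = Complex.exp (↑(Real.pi / L) * I) • (1 : Matrix (Fin 3) (Fin 3) ℂ)) :
    ω ^ L = -1 := by
  apply Subtype.ext
  have hL : (L : ℂ) ≠ 0 := Nat.cast_ne_zero.2 (NeZero.ne L)
  have harg : (L : ℂ) * (↑(Real.pi / L) * I) = Real.pi * I := by
    rw [Complex.ofReal_div, Complex.ofReal_natCast]
    field_simp
  rw [SubmonoidClass.coe_pow, hω, smul_pow, one_pow, ← Complex.exp_nat_mul, harg,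
    Complex.exp_pi_mul_I, Unitary.coe_neg, OneMemClass.coe_one, neg_smul, one_smul]

/-- `val (-1) = L - 1` in `ZMod L`, `L ≥ 1`. -/
private theorem zmod_val_neg_one {L : ℕ} [NeZero L] : (-1 : ZMod L).val = L - 1 := by
  obtain ⟨n, rfl⟩ := Nat.exists_eq_succ_of_ne_zero (NeZero.ne L)
  rw [ZMod.val_neg_one, Nat.succ_sub_one]

/-- `val (a + 1) = val a + 1` unless `a = -1`. -/
private theorem zmod_val_add_one {L : ℕ} [NeZero L] {a : ZMod L} (ha : a ≠ -1) :
    (a + 1).val = a.val + 1 := by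
  have hL1 : L ≠ 1 := by rintro rfl; exact ha (Subsingleton.elim _ _)
  have h1 : (1 : ZMod L).val = 1 := ZMod.val_one'' hL1
  have hlt : a.val + 1 < L := by
    by_contra hge
    apply ha
    have hval : a.val = L - 1 := by have := ZMod.val_lt a; omega
    have h0 : a + 1 = 0 := by
      rw [← ZMod.val_eq_zero, ZMod.val_add, h1, hval, Nat.sub_add_cancel NeZero.one_le,
        Nat.mod_self]
    exact eq_neg_of_add_eq_zero_left h0
  rw [ZMod.val_add_of_lt (by rwa [h1]), h1]

/-- On an even torus the parity of `val` is additive under `+1` (the wrap `L - 1 ↦ 0` is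
`odd ↦ even`). -/
private theorem zmod_val_add_one_mod_two {L : ℕ} [NeZero L] (hL : Even L) (a : ZMod L) :
    (a + 1).val % 2 = (a.val + 1) % 2 := by
  have hL1 : L ≠ 1 := by rintro rfl; exact Nat.not_even_one hL
  rw [ZMod.val_add, ZMod.val_one'' hL1]
  exact Nat.mod_mod_of_dvd _ (even_iff_two_dvd.1 hL)

/-- `(x + μ̂)_μ = x_μ + 1`. -/
private theorem shift_apply_self {L : ℕ} (x : Site 4 L) (μ : Fin 4) :
    Site.shift x μ μ = x μ + 1 := by
  simp [QuantumFieldTheory.Site.shift]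

/-- `(x + μ̂)_ν = x_ν` for `ν ≠ μ`. -/
private theorem shift_apply_of_ne {L : ℕ} (x : Site 4 L) {μ ν : Fin 4} (h : ν ≠ μ) :
    Site.shift x μ ν = x ν := by
  simp [QuantumFieldTheory.Site.shift, Pi.single_eq_of_ne h]

/-- **Seam ↔ phase.**  With `s x := ω ^ (Σ_ν val x_ν)`, the gauge transform of the constant-phase
field `e ↦ ω W_e` by `s` is the seam-twisted field `apTwistAt (fun _ => -1) W`: off the seam the
scalar factor is `ω^{n+1} ω^{-(n+1)} = 1`, on the seam `x_μ = -1` the exponent drops by `L - 1`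
and the factor is `ω^L = -1`. -/
private theorem gaugeTransform_phase_eq_apTwistAt {L : ℕ} [NeZero L]
    {ω : Matrix.unitaryGroup (Fin 3) ℂ}
    (hω : (ω : Matrix (Fin 3) (Fin 3) ℂ) = Complex.exp (↑(Real.pi / L) * I) • (1 : Matrix (Fin 3) (Fin 3) ℂ))
    (W : GaugeConfig 4 L (Matrix.unitaryGroup (Fin 3) ℂ)) :
    gaugeTransform (fun x : Site 4 L => ω ^ (∑ ν, (x ν).val)) (fun e => ω * W e) =
      apTwistAt (fun _ => (-1 : ZMod L)) W := by
  funext ⟨x, μ⟩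
  rw [apTwistAt_apply]
  simp only [gaugeTransform]
  have hx : ∑ ν, (x ν).val = (x μ).val + ∑ ν ∈ Finset.univ.erase μ, (x ν).val :=
    (Finset.add_sum_erase _ _ (Finset.mem_univ μ)).symm
  have hxs : ∑ ν, (Site.shift x μ ν).val = (x μ + 1).val + ∑ ν ∈ Finset.univ.erase μ, (x ν).val := by
    rw [← Finset.add_sum_erase _ _ (Finset.mem_univ μ), shift_apply_self]
    congr 1
    exact Finset.sum_congr rfl fun ν hν => by rw [shift_apply_of_ne x (Finset.ne_of_mem_erase hν)]
  rw [hx, hxs]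
  set n := ∑ ν ∈ Finset.univ.erase μ, (x ν).val with hn
  have hre : ω ^ ((x μ).val + n) * (ω * W (x, μ)) * (ω ^ ((x μ + 1).val + n))⁻¹ =
      ω ^ ((x μ).val + n + 1) * (ω ^ ((x μ + 1).val + n))⁻¹ * W (x, μ) := by
    rw [← mul_assoc (ω ^ _) ω, ← pow_succ, mul_assoc, mul_assoc,
      (((phase_comm hω (W (x, μ))).pow_left _).inv_left).eq]
  rw [hre]
  by_cases h : x μ = -1
  · rw [if_pos h, h, neg_add_cancel, ZMod.val_zero, zero_add, zmod_val_neg_one,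
      show L - 1 + n + 1 = L + n by have := NeZero.one_le (n := L); omega, pow_add,
      mul_inv_cancel_right, phase_pow hω, neg_one_mul]
  · rw [if_neg h, zmod_val_add_one h, add_right_comm (x μ).val n 1, mul_inv_cancel, one_mul]

/-- **Every-gauge form of Theorem A.**  If `‖det D[ω • V]‖ ≤ e^{C F(V)} ‖det D[ω • 1]‖` for every
field `V` (`F(V) = Σ_e (3 - Re tr V_e)`), then for every field `W` and every gauge `g`,
`‖det D[apTwistAt (-1) W]‖ ≤ e^{C F(W^g)} ‖det D[apTwistAt (-1) 1]‖`: both sides are rewritten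
through the seam ↔ phase gauge equivalence and the gauge invariance of the fermion determinant. -/
private theorem norm_det_apTwistAt_le {L : ℕ} [NeZero L] {m C : ℝ}
    {ω : Matrix.unitaryGroup (Fin 3) ℂ}
    (hω : (ω : Matrix (Fin 3) (Fin 3) ℂ) = Complex.exp (↑(Real.pi / L) * I) • (1 : Matrix (Fin 3) (Fin 3) ℂ))
    (hA : ∀ V : GaugeConfig 4 L (Matrix.unitaryGroup (Fin 3) ℂ),
      ‖(wilsonDirac (unitaryFundamentalRep (Fin 3) ℂ) (fun e => ω * V e) m 1).det‖ ≤
        Real.exp (C * ∑ e : Edge 4 L, (3 - (((V e : Matrix.unitaryGroup (Fin 3) ℂ) :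
          Matrix (Fin 3) (Fin 3) ℂ)).trace.re)) *
          ‖(wilsonDirac (unitaryFundamentalRep (Fin 3) ℂ)
              (fun _ : Edge 4 L => ω) m 1).det‖)
    (W : GaugeConfig 4 L (Matrix.unitaryGroup (Fin 3) ℂ)) (g : Site 4 L → Matrix.unitaryGroup (Fin 3) ℂ) :
    ‖(wilsonDirac (unitaryFundamentalRep (Fin 3) ℂ) (apTwistAt (fun _ => (-1 : ZMod L)) W) m 1).det‖ ≤
      Real.exp (C * ∑ e : Edge 4 L, (3 - (((gaugeTransform g W e : Matrix.unitaryGroup (Fin 3) ℂ) :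
          Matrix (Fin 3) (Fin 3) ℂ)).trace.re)) *
        ‖(wilsonDirac (unitaryFundamentalRep (Fin 3) ℂ)
            (apTwistAt (fun _ => (-1 : ZMod L))
              (1 : GaugeConfig 4 L (Matrix.unitaryGroup (Fin 3) ℂ))) m 1).det‖ := by
  have h1 : (wilsonDirac (unitaryFundamentalRep (Fin 3) ℂ) (apTwistAt (fun _ => (-1 : ZMod L)) W) m 1).det =
      (wilsonDirac (unitaryFundamentalRep (Fin 3) ℂ) (fun e => ω * gaugeTransform g W e) m 1).det :=
    calc (wilsonDirac (unitaryFundamentalRep (Fin 3) ℂ) (apTwistAt (fun _ => (-1 : ZMod L)) W) m 1).det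
        = (wilsonDirac (unitaryFundamentalRep (Fin 3) ℂ)
            (gaugeTransform g (apTwistAt (fun _ => (-1 : ZMod L)) W)) m 1).det :=
          (fermionDet_wilsonDirac_gaugeTransform _ g _ m 1).symm
      _ = (wilsonDirac (unitaryFundamentalRep (Fin 3) ℂ)
            (gaugeTransform (fun x : Site 4 L => ω ^ (∑ ν, (x ν).val))
              (fun e => ω * gaugeTransform g W e)) m 1).det := by
          rw [← apTwistAt_gaugeTransform, gaugeTransform_phase_eq_apTwistAt hω]
      _ = (wilsonDirac (unitaryFundamentalRep (Fin 3) ℂ) (fun e => ω * gaugeTransform g W e) m 1).det :=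
          fermionDet_wilsonDirac_gaugeTransform _ _ _ m 1
  have h2 : (wilsonDirac (unitaryFundamentalRep (Fin 3) ℂ)
        (fun _ : Edge 4 L => ω) m 1).det =
      (wilsonDirac (unitaryFundamentalRep (Fin 3) ℂ)
        (apTwistAt (fun _ => (-1 : ZMod L)) (1 : GaugeConfig 4 L (Matrix.unitaryGroup (Fin 3) ℂ))) m 1).det := by
    have h := fermionDet_wilsonDirac_gaugeTransform (unitaryFundamentalRep (Fin 3) ℂ)
      (fun x : Site 4 L => ω ^ (∑ ν, (x ν).val))
      (fun e => ω * (1 : GaugeConfig 4 L (Matrix.unitaryGroup (Fin 3) ℂ)) e) m 1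
    rw [gaugeTransform_phase_eq_apTwistAt hω] at h
    simp only [Pi.one_apply, mul_one] at h
    exact h.symm
  rw [h1, ← h2]
  exact hA _

/-- The fold `x ↦ c + ((x - c) mod 2)` commutes with the shift `+μ̂` at sites of even
`μ`-offset (even `L`). -/
private theorem fold_shift_of_even {L : ℕ} [NeZero L] (hL : Even L) (c x : Site 4 L) (μ : Fin 4)
    (h : (x μ - c μ).val % 2 = 0) :
    (fun ν => c ν + (((Site.shift x μ ν - c ν).val % 2 : ℕ) : ZMod L)) =
      Site.shift (fun ν => c ν + (((x ν - c ν).val % 2 : ℕ) : ZMod L)) μ := by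
  funext ν
  by_cases hν : ν = μ
  · subst hν
    have h1 : ((x ν - c ν).val + 1) % 2 = 1 := by omega
    rw [shift_apply_self, shift_apply_self, add_sub_right_comm, zmod_val_add_one_mod_two hL, h, h1,
      Nat.cast_one, Nat.cast_zero, add_zero]
  · rw [shift_apply_of_ne x hν, shift_apply_of_ne _ hν]

/-- ... and is undone by the shift `+μ̂` at sites of odd `μ`-offset (even `L`). -/
private theorem shift_fold_shift_of_odd {L : ℕ} [NeZero L] (hL : Even L) (c x : Site 4 L) (μ : Fin 4)
    (h : ¬(x μ - c μ).val % 2 = 0) :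
    Site.shift (fun ν => c ν + (((Site.shift x μ ν - c ν).val % 2 : ℕ) : ZMod L)) μ =
      fun ν => c ν + (((x ν - c ν).val % 2 : ℕ) : ZMod L) := by
  funext ν
  by_cases hν : ν = μ
  · subst hν
    have h1 : (x ν - c ν).val % 2 = 1 := by omega
    have h0 : ((x ν - c ν).val + 1) % 2 = 0 := by omega
    rw [shift_apply_self, shift_apply_self, add_sub_right_comm, zmod_val_add_one_mod_two hL, h0, h1,
      Nat.cast_one, Nat.cast_zero, add_zero]
  · rw [shift_apply_of_ne _ hν, shift_apply_of_ne x hν]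

/-- **The fold identity** for the period-2 reflection tiling `tile_c` of `QuarkChessboard`
(even `L`): `(tile_c V)^{g ∘ fold_c} = tile_c (V^g)`. -/
private theorem gaugeTransform_tile {L : ℕ} [NeZero L] (hL : Even L)
    (g : Site 4 L → Matrix.unitaryGroup (Fin 3) ℂ)
    (V : GaugeConfig 4 L (Matrix.unitaryGroup (Fin 3) ℂ)) (c : Site 4 L) :
    gaugeTransform (fun x => g (fun ν => c ν + (((x ν - c ν).val % 2 : ℕ) : ZMod L)))
        (fun e => if (e.1 e.2 - c e.2).val % 2 = 0
          then V (fun ν => c ν + (((e.1 ν - c ν).val % 2 : ℕ) : ZMod L), e.2)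
          else (V (fun ν => c ν + (((Site.shift e.1 e.2 ν - c ν).val % 2 : ℕ) : ZMod L), e.2))⁻¹) =
      fun e : Edge 4 L => if (e.1 e.2 - c e.2).val % 2 = 0
          then gaugeTransform g V (fun ν => c ν + (((e.1 ν - c ν).val % 2 : ℕ) : ZMod L), e.2)
          else (gaugeTransform g V
            (fun ν => c ν + (((Site.shift e.1 e.2 ν - c ν).val % 2 : ℕ) : ZMod L), e.2))⁻¹ := by
  funext e
  simp only [gaugeTransform]
  split_ifs with h
  · rw [fold_shift_of_even hL c e.1 e.2 h]
  · rw [_root_.mul_inv_rev, _root_.mul_inv_rev, inv_inv, shift_fold_shift_of_odd hL c e.1 e.2 h,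
      mul_assoc]

/-- `Re tr u ≤ 3` on `U(3)`: the link deficit is non-negative. -/
private theorem deficit_nonneg (u : Matrix.unitaryGroup (Fin 3) ℂ) :
    0 ≤ 3 - ((u : Matrix (Fin 3) (Fin 3) ℂ)).trace.re := by
  rw [sub_nonneg, Matrix.trace, Complex.re_sum]
  calc ∑ i, (Matrix.diag (u : Matrix (Fin 3) (Fin 3) ℂ) i).re
      ≤ ∑ _i : Fin 3, (1 : ℝ) := Finset.sum_le_sum fun i _ =>
        (Complex.re_le_norm _).trans (entry_norm_bound_of_unitary u.2 i i)
    _ = 3 := by simp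

/-- `Re tr u⁻¹ = Re tr u` on `U(3)` (`u⁻¹ = u†`). -/
private theorem trace_re_inv (u : Matrix.unitaryGroup (Fin 3) ℂ) :
    (((u⁻¹ : Matrix.unitaryGroup (Fin 3) ℂ) : Matrix (Fin 3) (Fin 3) ℂ)).trace.re =
      ((u : Matrix (Fin 3) (Fin 3) ℂ)).trace.re := by
  rw [Matrix.UnitaryGroup.inv_val, Matrix.star_eq_conjTranspose, Matrix.trace_conjTranspose,
    Complex.star_def, Complex.conj_re]

/-- **Link count.**  Every link of the tiling `tile_c X` is `X(ℓ)` or `X(ℓ)⁻¹` for a CELL link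
`ℓ` (folded sites have offsets in `{0, 1}`, and the `μ`-offset of the folded base point is even,
i.e. `0` — for the inverted links because `L` is even), so its deficit is at most the total
cell deficit; summing over the `4 L⁴` links of the torus gives
`F(tile_c X) ≤ 4 L⁴ · Σ_{cell links} deficit(X)`. -/
private theorem sum_deficit_tile_le {L : ℕ} [NeZero L] (hL : Even L)
    (X : GaugeConfig 4 L (Matrix.unitaryGroup (Fin 3) ℂ)) (c : Site 4 L) :
    (∑ e : Edge 4 L, (3 - ((((fun e : Edge 4 L => if (e.1 e.2 - c e.2).val % 2 = 0
          then X (fun ν => c ν + (((e.1 ν - c ν).val % 2 : ℕ) : ZMod L), e.2)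
          else (X (fun ν => c ν + (((Site.shift e.1 e.2 ν - c ν).val % 2 : ℕ) : ZMod L), e.2))⁻¹) e :
            Matrix.unitaryGroup (Fin 3) ℂ) : Matrix (Fin 3) (Fin 3) ℂ)).trace.re)) ≤
      4 * (L : ℝ) ^ 4 * ∑ e ∈ Finset.univ.filter (fun e : Edge 4 L =>
          (∀ ν, (e.1 ν - c ν).val ≤ 1) ∧ (e.1 e.2 - c e.2).val = 0),
        (3 - (((X e : Matrix.unitaryGroup (Fin 3) ℂ) : Matrix (Fin 3) (Fin 3) ℂ)).trace.re) := by
  have hL2 : 2 ≤ L := by obtain ⟨k, hk⟩ := hL; have := NeZero.ne L; omega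
  have hval : ∀ (y : Site 4 L) (ν : Fin 4),
      (c ν + (((y ν - c ν).val % 2 : ℕ) : ZMod L) - c ν).val = (y ν - c ν).val % 2 := fun y ν => by
    rw [add_sub_cancel_left, ZMod.val_cast_of_lt (by omega)]
  have hmem : ∀ (y : Site 4 L) (μ : Fin 4), (y μ - c μ).val % 2 = 0 →
      ((fun ν => c ν + (((y ν - c ν).val % 2 : ℕ) : ZMod L)), μ) ∈
        Finset.univ.filter (fun e : Edge 4 L =>
          (∀ ν, (e.1 ν - c ν).val ≤ 1) ∧ (e.1 e.2 - c e.2).val = 0) := fun y μ hy => by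
    refine Finset.mem_filter.2 ⟨Finset.mem_univ _, fun ν => ?_, ?_⟩
    · rw [hval]
      omega
    · rw [hval, hy]
  have key : ∀ e : Edge 4 L, (3 - ((((fun e : Edge 4 L => if (e.1 e.2 - c e.2).val % 2 = 0
          then X (fun ν => c ν + (((e.1 ν - c ν).val % 2 : ℕ) : ZMod L), e.2)
          else (X (fun ν => c ν + (((Site.shift e.1 e.2 ν - c ν).val % 2 : ℕ) : ZMod L), e.2))⁻¹) e :
            Matrix.unitaryGroup (Fin 3) ℂ) : Matrix (Fin 3) (Fin 3) ℂ)).trace.re) ≤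
      ∑ e ∈ Finset.univ.filter (fun e : Edge 4 L =>
          (∀ ν, (e.1 ν - c ν).val ≤ 1) ∧ (e.1 e.2 - c e.2).val = 0),
        (3 - (((X e : Matrix.unitaryGroup (Fin 3) ℂ) : Matrix (Fin 3) (Fin 3) ℂ)).trace.re) := by
    intro e
    dsimp only
    split_ifs with h
    · exact Finset.single_le_sum (f := fun e : Edge 4 L =>
          (3 - (((X e : Matrix.unitaryGroup (Fin 3) ℂ) : Matrix (Fin 3) (Fin 3) ℂ)).trace.re))
        (fun e _ => deficit_nonneg _) (hmem e.1 e.2 h)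
    · rw [trace_re_inv]
      refine Finset.single_le_sum (f := fun e : Edge 4 L =>
          (3 - (((X e : Matrix.unitaryGroup (Fin 3) ℂ) : Matrix (Fin 3) (Fin 3) ℂ)).trace.re))
        (fun e _ => deficit_nonneg _) (hmem (Site.shift e.1 e.2) e.2 ?_)
      have h0 : ((e.1 e.2 - c e.2).val + 1) % 2 = 0 := by omega
      rw [shift_apply_self, add_sub_right_comm, zmod_val_add_one_mod_two hL, h0]
  refine (Finset.sum_le_sum fun e _ => key e).trans (le_of_eq ?_)
  rw [Finset.sum_const, Finset.card_univ, nsmul_eq_mul]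
  congr 1
  simp [Fintype.card_prod, ZMod.card, Fintype.card_fin, mul_comm]

/-- Steps (b)–(d) combined: for every gauge `g` and every cell corner `c`,
`‖det D[apTwistAt (-1) (tile_c V)]‖ ≤ exp(C · 4L⁴ · Σ_{cell links} deficit(V^g)) · ‖det D[apTwistAt (-1) 1]‖`. -/
private theorem tiling_bound {L : ℕ} [NeZero L] (hL : Even L) {m C : ℝ} (hC : 0 ≤ C)
    {ω : Matrix.unitaryGroup (Fin 3) ℂ}
    (hω : (ω : Matrix (Fin 3) (Fin 3) ℂ) = Complex.exp (↑(Real.pi / L) * I) • (1 : Matrix (Fin 3) (Fin 3) ℂ))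
    (hA : ∀ V : GaugeConfig 4 L (Matrix.unitaryGroup (Fin 3) ℂ),
      ‖(wilsonDirac (unitaryFundamentalRep (Fin 3) ℂ) (fun e => ω * V e) m 1).det‖ ≤
        Real.exp (C * ∑ e : Edge 4 L, (3 - (((V e : Matrix.unitaryGroup (Fin 3) ℂ) :
          Matrix (Fin 3) (Fin 3) ℂ)).trace.re)) *
          ‖(wilsonDirac (unitaryFundamentalRep (Fin 3) ℂ)
              (fun _ : Edge 4 L => ω) m 1).det‖)
    (V : GaugeConfig 4 L (Matrix.unitaryGroup (Fin 3) ℂ)) (c : Site 4 L)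
    (g : Site 4 L → Matrix.unitaryGroup (Fin 3) ℂ) :
    ‖(wilsonDirac (unitaryFundamentalRep (Fin 3) ℂ)
        (apTwistAt (fun _ => (-1 : ZMod L))
          (fun e => if (e.1 e.2 - c e.2).val % 2 = 0
            then V (fun ν => c ν + (((e.1 ν - c ν).val % 2 : ℕ) : ZMod L), e.2)
            else (V (fun ν => c ν + (((Site.shift e.1 e.2 ν - c ν).val % 2 : ℕ) : ZMod L), e.2))⁻¹))
        m 1).det‖ ≤
      Real.exp (C * (4 * (L : ℝ) ^ 4 * ∑ e ∈ Finset.univ.filter (fun e : Edge 4 L =>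
            (∀ ν, (e.1 ν - c ν).val ≤ 1) ∧ (e.1 e.2 - c e.2).val = 0),
          (3 - (((gaugeTransform g V e : Matrix.unitaryGroup (Fin 3) ℂ) :
            Matrix (Fin 3) (Fin 3) ℂ)).trace.re))) *
        ‖(wilsonDirac (unitaryFundamentalRep (Fin 3) ℂ)
            (apTwistAt (fun _ => (-1 : ZMod L)) (1 : GaugeConfig 4 L (Matrix.unitaryGroup (Fin 3) ℂ)))
            m 1).det‖ := by
  refine (norm_det_apTwistAt_le hω hA _
    (fun x => g (fun ν => c ν + (((x ν - c ν).val % 2 : ℕ) : ZMod L)))).trans ?_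
  refine mul_le_mul_of_nonneg_right (Real.exp_le_exp.2 (mul_le_mul_of_nonneg_left ?_ hC))
    (norm_nonneg _)
  rw [gaugeTransform_tile hL g V c]
  exact sum_deficit_tile_le hL (gaugeTransform g V) c

/-- **Stub `stub_tilingStability_of`**: `FreeTangentBound → CellGauge → TilingStability` (stated
unfolded) — Theorem A (free-tangent bound in the constant phase `ω = e^{iπ/L}·1`, gauge `1`) and
Theorem B (cell gauge fixing) give the stability of the period-2 reflection tilings with antiperiodic
seam on even tori, constants `ε_A`, `C := 4 C_A max(C_B, 0)`, `L₀ := max(L₀^A, 4)` (see the module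
docstring for the proof). -/
theorem stub_tilingStability_of :
    (∃ ε C : ℝ, 0 < ε ∧ 0 ≤ C ∧ ∃ L₀ : ℕ, ∀ (L : ℕ) [NeZero L], L₀ ≤ L → ∀ m : ℝ, |m| ≤ ε →
      ∀ (ω : Matrix.unitaryGroup (Fin 3) ℂ),
        (ω : Matrix (Fin 3) (Fin 3) ℂ) = Complex.exp (↑(Real.pi / L) * I) • (1 : Matrix (Fin 3) (Fin 3) ℂ) →
        ∀ V : GaugeConfig 4 L (Matrix.unitaryGroup (Fin 3) ℂ),
          ‖(wilsonDirac (unitaryFundamentalRep (Fin 3) ℂ) (fun e => ω * V e) m 1).det‖ ≤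
            Real.exp (C * ∑ e : Edge 4 L, (3 - (((V e : Matrix.unitaryGroup (Fin 3) ℂ) : Matrix (Fin 3) (Fin 3) ℂ)).trace.re)) *
              ‖(wilsonDirac (unitaryFundamentalRep (Fin 3) ℂ)
                  (fun _ : Edge 4 L => ω) m 1).det‖) →
    (∃ C : ℝ, ∀ (L : ℕ) [NeZero L], 4 ≤ L →
      ∀ (V : GaugeConfig 4 L (Matrix.unitaryGroup (Fin 3) ℂ)) (c : Site 4 L),
        ∃ g : Site 4 L → Matrix.unitaryGroup (Fin 3) ℂ,
          (∑ e ∈ Finset.univ.filter (fun e : Edge 4 L =>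
              (∀ ν, (e.1 ν - c ν).val ≤ 1) ∧ (e.1 e.2 - c e.2).val = 0),
            (3 - (((gaugeTransform g V e : Matrix.unitaryGroup (Fin 3) ℂ) : Matrix (Fin 3) (Fin 3) ℂ)).trace.re)) ≤
          C * ∑ p ∈ Finset.univ.filter (fun p : Plaquette 4 L =>
              (∀ ν, (p.1 ν - c ν).val ≤ 1) ∧ (p.1 p.2.1.1 - c p.2.1.1).val = 0 ∧
                (p.1 p.2.1.2 - c p.2.1.2).val = 0),
            (3 - (((plaquetteHolonomy V p.1 p.2.1.1 p.2.1.2 : Matrix.unitaryGroup (Fin 3) ℂ) : Matrix (Fin 3) (Fin 3) ℂ)).trace.re)) →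
    (∃ ε C : ℝ, 0 < ε ∧ 0 ≤ C ∧ ∃ L₀ : ℕ, ∀ (L : ℕ) [NeZero L], L₀ ≤ L → Even L → ∀ m : ℝ, |m| ≤ ε →
      ∀ (V : GaugeConfig 4 L (Matrix.unitaryGroup (Fin 3) ℂ)) (c : Site 4 L),
        ‖(wilsonDirac (unitaryFundamentalRep (Fin 3) ℂ)
            (apTwistAt (fun _ => (-1 : ZMod L))
              (fun e => if (e.1 e.2 - c e.2).val % 2 = 0
                then V (fun ν => c ν + (((e.1 ν - c ν).val % 2 : ℕ) : ZMod L), e.2)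
                else (V (fun ν => c ν + (((Site.shift e.1 e.2 ν - c ν).val % 2 : ℕ) : ZMod L), e.2))⁻¹))
            m 1).det‖ ≤
          Real.exp (C * (L : ℝ) ^ 4 * ∑ p ∈ Finset.univ.filter (fun p : Plaquette 4 L =>
              (∀ ν, (p.1 ν - c ν).val ≤ 1) ∧ (p.1 p.2.1.1 - c p.2.1.1).val = 0 ∧
                (p.1 p.2.1.2 - c p.2.1.2).val = 0),
            (3 - (((plaquetteHolonomy V p.1 p.2.1.1 p.2.1.2 : Matrix.unitaryGroup (Fin 3) ℂ) :
              Matrix (Fin 3) (Fin 3) ℂ)).trace.re)) *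
            ‖(wilsonDirac (unitaryFundamentalRep (Fin 3) ℂ)
                (apTwistAt (fun _ => (-1 : ZMod L)) (1 : GaugeConfig 4 L (Matrix.unitaryGroup (Fin 3) ℂ)))
                m 1).det‖) := by
  rintro ⟨ε, CA, hε, hCA, L₀, hA⟩ ⟨CB, hB⟩
  refine ⟨ε, 4 * CA * max CB 0, hε, by positivity, max L₀ 4, ?_⟩
  intro L _ hL hEven m hm V c
  have hL₀ : L₀ ≤ L := le_of_max_le_left hL
  have hL4 : 4 ≤ L := le_of_max_le_right hL
  obtain ⟨g, hg⟩ := hB L hL4 V c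
  have hω : ((⟨_, phase_mem_unitaryGroup L⟩ : Matrix.unitaryGroup (Fin 3) ℂ) :
      Matrix (Fin 3) (Fin 3) ℂ) = Complex.exp (↑(Real.pi / L) * I) • (1 : Matrix (Fin 3) (Fin 3) ℂ) :=
    rfl
  refine (tiling_bound hEven hCA hω (hA L hL₀ m hm _ hω) V c g).trans
    (mul_le_mul_of_nonneg_right (Real.exp_le_exp.2 ?_) (norm_nonneg _))
  have h1 := hg.trans (mul_le_mul_of_nonneg_right (le_max_left CB 0)
    (Finset.sum_nonneg fun p _ => deficit_nonneg _))
  have h2 := mul_nonneg (mul_nonneg hCA (by positivity : (0 : ℝ) ≤ 4 * (L : ℝ) ^ 4))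
    (sub_nonneg.2 h1)
  nlinarith [h2]

end

end Summit.QuantumFields.QCD.Cruxes.WilsonQuarkStability.FreeTangentLandauChessboard
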